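import Summits.HodgeConjecture.HodgeConjecture.Theorems.BiquadraticSecantLiftDefs
import Summits.HodgeConjecture.HodgeConjecture.Theorems.BiquadraticSecantLiftBaseChangePoly
import Literature.AlgebraicGeometry.Deligne1982.WeilTypeCMFieldIsCM
import Literature.AlgebraicGeometry.Deligne1982.WeilTypeCMDiscriminantExists
import HarnessLib

/-!
# BiquadraticSecantLift · X2 — the biquadratic CM field `L = ℚ[T]/(R_(d,m)(T²)) = ℚ(√-d, √m)`:
# `√m`, `√-d ∈ L`, the embedding `K = ℚ(√-d) ↪ L`, and `√m ∉ K`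

Helper file for crux X2 `BiquadraticBaseChangeHyperbolic` (stmt-HodgeConjecture-22133) of
route-HodgeConjecture-BiquadraticSecantLift. On Deligne's presentation `L = cmField (bqPoly d m)` (`t = cmRoot`,
`t⁴ + 2d(1+m)t² + d²(m-1)² = 0`; `d ≥ 1`, `m` not a square) we name `√m = sqrtM d m = -(t²/d + 1 + m)/2` (with
`(√m)² = m`, `t² = -d(1+√m)²`, fixed by `cmConj`, the image of `sqrtMReal d m ∈ F = realField`) and
`√-d = iK d m = t(1-√m)/(1-m)` (with `(√-d)² = -d`, `√-d·(1+√m) = t`, `cmConj √-d = -√-d`), the embedding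
`toL d m : K = cmField (S + d) →ₐ[ℚ] L`, `t_K ↦ √-d` (intertwining the conjugations), the presentation `K = ℚ ⊕ ℚ t_K`,
and `√m ∉ toL(K)`. The rational constants enter through `algebraMap ℚ L` (no division in `L` is used in the
definitions, so that only the `AdjoinRoot` algebra structure occurs). Pure field arithmetic; nothing here is a case
of the Hodge conjecture (HC is NOT proved; X2 is not proved by this file).

## References
[cite: Deligne1982HodgeCycles, §4 p. 30 (`E = F(η)`, `η̄ = -η`)] [cite: DummitFoote2004, §14.6 Exercise 13]
-/

-- every declaration of this problem lives in `Summit.HodgeConjecture.HodgeConjecture.…` (summit = sub-problem)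
set_option linter.dupNamespace false

noncomputable section

open Polynomial
open Literature.AlgebraicGeometry.Deligne1982

namespace Summit.HodgeConjecture.HodgeConjecture.BiquadraticSecantLift

/-! ## §1 Definitions (no field structure needed) -/

section Defs

variable (d m : ℕ)

/-- `P_R = R_(d,m)(T²) = T⁴ + 2d(1+m)T² + d²(m-1)²` over `ℚ`. -/
theorem cmPolyQ_bqPoly : cmPolyQ (bqPoly d m) =
    X ^ 4 + C (2 * (d : ℚ) * (1 + (m : ℚ))) * X ^ 2 + C ((d : ℚ) ^ 2 * ((m : ℚ) - 1) ^ 2) := by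
  rw [cmPolyQ, bqPoly_eq, bq_comp_X_sq]
  simp only [Polynomial.map_add, Polynomial.map_mul, Polynomial.map_pow, Polynomial.map_X, Polynomial.map_C,
    Int.coe_castRingHom, Int.cast_mul, Int.cast_ofNat, Int.cast_natCast, Int.cast_add, Int.cast_one, Int.cast_pow,
    Int.cast_sub]

/-- **`t⁴ + 2d(1+m)t² + d²(m-1)² = 0`** for `t = cmRoot (bqPoly d m)`. -/
theorem cmRoot_bqPoly_relation :
    cmRoot (bqPoly d m) ^ 4 + 2 * (d : cmField (bqPoly d m)) * (1 + (m : cmField (bqPoly d m))) * cmRoot (bqPoly d m) ^ 2 +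
      (d : cmField (bqPoly d m)) ^ 2 * ((m : cmField (bqPoly d m)) - 1) ^ 2 = 0 := by
  have h := AdjoinRoot.eval₂_root (cmPolyQ (bqPoly d m))
  rw [cmPolyQ_bqPoly] at h
  simp only [eval₂_add, eval₂_mul, eval₂_pow, eval₂_X, eval₂_C] at h
  simp only [map_mul, map_add, map_one, map_pow, map_sub, map_natCast, map_ofNat] at h
  rw [← cmPolyQ_bqPoly] at h
  exact h

/-- `√m ∈ L`: `sqrtM d m = -(1/(2d))·t² - (1+m)/2` (so that `t² = -d(1 + √m)²`). -/
def sqrtM : cmField (bqPoly d m) :=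
  algebraMap ℚ (cmField (bqPoly d m)) (-(1 / (2 * (d : ℚ)))) * cmRoot (bqPoly d m) ^ 2 -
    algebraMap ℚ (cmField (bqPoly d m)) ((1 + (m : ℚ)) / 2)

/-- `√-d ∈ L`: `iK d m = (1-m)⁻¹ · t · (1 - √m)`. -/
def iK : cmField (bqPoly d m) :=
  algebraMap ℚ (cmField (bqPoly d m)) ((1 - (m : ℚ))⁻¹) * (cmRoot (bqPoly d m) * (1 - sqrtM d m))

/-- `√m ∈ F = realField (bqPoly d m)`: `sqrtMReal d m = -(1/(2d))·S - (1+m)/2` (`ι S = t²`). -/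
def sqrtMReal : realField (bqPoly d m) :=
  AdjoinRoot.of (realPolyQ (bqPoly d m)) (-(1 / (2 * (d : ℚ)))) * AdjoinRoot.root (realPolyQ (bqPoly d m)) -
    AdjoinRoot.of (realPolyQ (bqPoly d m)) ((1 + (m : ℚ)) / 2)

/-- `ι(√m_F) = √m`. -/
theorem realToCM_sqrtMReal : realToCM (bqPoly d m) (sqrtMReal d m) = sqrtM d m := by
  rw [sqrtMReal, sqrtM, map_sub, map_mul, realToCM_of, realToCM_of, realToCM_root]

/-- `cmConj √m = √m` (`√m ∈ F`). -/
theorem cmConj_sqrtM : cmConj (bqPoly d m) (sqrtM d m) = sqrtM d m := by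
  rw [← realToCM_sqrtMReal, cmConj_realToCM]

/-- `cmConj √-d = -√-d`. -/
theorem cmConj_iK : cmConj (bqPoly d m) (iK d m) = -iK d m := by
  rw [iK, map_mul, AlgHom.commutes, map_mul, map_sub, map_one, cmConj_cmRoot, cmConj_sqrtM]
  ring

/-- `P_{S+d} = T² + d` over `ℚ`. -/
theorem cmPolyQ_quadratic : cmPolyQ (X + C (d : ℤ)) = X ^ 2 + C (d : ℚ) := by
  rw [cmPolyQ, X_add_C_comp_X_sq]
  simp only [Polynomial.map_add, Polynomial.map_pow, Polynomial.map_X, Polynomial.map_C, Int.coe_castRingHom,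
    Int.cast_natCast]

/-- `t_K² = -d` for `t_K = cmRoot (S + d)`. -/
theorem cmRoot_quadratic_sq : cmRoot (X + C (d : ℤ)) ^ 2 = -(d : cmField (X + C (d : ℤ))) := by
  have h := AdjoinRoot.eval₂_root (cmPolyQ (X + C (d : ℤ)))
  rw [cmPolyQ_quadratic] at h
  simp only [eval₂_add, eval₂_pow, eval₂_X, eval₂_C] at h
  simp only [map_natCast] at h
  rw [← cmPolyQ_quadratic] at h
  exact eq_neg_of_add_eq_zero_left h

/-- `R_{S+d}(x) = x + d` under any evaluation. -/
theorem eval₂_realPolyQ_quadratic {S : Type*} [CommRing S] (f : ℚ →+* S) (x : S) :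
    eval₂ f x (realPolyQ (X + C (d : ℤ))) = x + (d : S) := by
  rw [realPolyQ, Polynomial.map_add, Polynomial.map_X, Polynomial.map_C, eval₂_add, eval₂_X, eval₂_C]
  simp only [map_natCast]

/-- Every element of the totally real subfield `F = ℚ[S]/(S + d) ≅ ℚ` of `K` is rational. -/
theorem exists_eq_algebraMap_realField_quadratic (f : realField (X + C (d : ℤ))) :
    ∃ r : ℚ, f = algebraMap ℚ (realField (X + C (d : ℤ))) r := by
  induction f using AdjoinRoot.induction_on with
  | ih p =>
    refine ⟨p.eval (-(d : ℚ)), ?_⟩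
    have hroot : AdjoinRoot.root (realPolyQ (X + C (d : ℤ))) = algebraMap ℚ _ (-(d : ℚ)) := by
      have h := AdjoinRoot.eval₂_root (realPolyQ (X + C (d : ℤ)))
      rw [eval₂_realPolyQ_quadratic] at h
      rw [map_neg, map_natCast]
      exact eq_neg_of_add_eq_zero_left h
    rw [← AdjoinRoot.aeval_eq, hroot, Polynomial.aeval_algebraMap_apply_eq_algebraMap_eval]

/-- **`K = ℚ ⊕ ℚ·t_K`**: every element of `K = cmField (S + d)` is `a + b·t_K` with `a, b ∈ ℚ`. -/
theorem exists_eq_add_mul_cmRoot_quadratic (z : cmField (X + C (d : ℤ))) :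
    ∃ a b : ℚ, z = algebraMap ℚ _ a + algebraMap ℚ _ b * cmRoot (X + C (d : ℤ)) := by
  obtain ⟨a', b', hz⟩ := exists_eq_realToCM_add_mul_cmRoot (X + C (d : ℤ)) z
  obtain ⟨a, ha⟩ := exists_eq_algebraMap_realField_quadratic d a'
  obtain ⟨b, hb⟩ := exists_eq_algebraMap_realField_quadratic d b'
  refine ⟨a, b, ?_⟩
  rw [hz, ha, hb, show algebraMap ℚ (realField (X + C (d : ℤ))) a = AdjoinRoot.of _ a from rfl, realToCM_of,
    show algebraMap ℚ (realField (X + C (d : ℤ))) b = AdjoinRoot.of _ b from rfl, realToCM_of]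

end Defs

/-! ## §2 Field identities in `L` (`L` a field: `Fact (Irreducible P_R)`) -/

section FieldFacts

variable (d m : ℕ)

/-- `L` has characteristic zero (when it is a field). -/
theorem charZero_cmField_bqPoly (hirr : Irreducible (cmPolyQ (bqPoly d m))) : CharZero (cmField (bqPoly d m)) :=
  haveI : Fact (Irreducible (cmPolyQ (bqPoly d m))) := ⟨hirr⟩
  charZero_of_injective_algebraMap (algebraMap ℚ (cmField (bqPoly d m))).injective

/-- `√m` in field form: `√m = -(t²/d + 1 + m)/2`. -/
theorem sqrtM_eq [hF : Fact (Irreducible (cmPolyQ (bqPoly d m)))] (hd : 0 < d) :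
    sqrtM d m = -(cmRoot (bqPoly d m) ^ 2 / (d : cmField (bqPoly d m)) + 1 + (m : cmField (bqPoly d m))) / 2 := by
  haveI := charZero_cmField_bqPoly d m hF.out
  have hd' : (d : cmField (bqPoly d m)) ≠ 0 := Nat.cast_ne_zero.2 hd.ne'
  rw [sqrtM]
  simp only [map_neg, map_div₀, map_one, map_mul, map_ofNat, map_natCast, map_add]
  field_simp
  ring

/-- **`t² = -d(1 + √m)²`.** -/
theorem cmRoot_sq_eq (hirr : Irreducible (cmPolyQ (bqPoly d m))) (hd : 0 < d) :
    cmRoot (bqPoly d m) ^ 2 = -((d : cmField (bqPoly d m)) * (1 + sqrtM d m) ^ 2) := by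
  haveI : Fact (Irreducible (cmPolyQ (bqPoly d m))) := ⟨hirr⟩
  haveI := charZero_cmField_bqPoly d m hirr
  have hd' : (d : cmField (bqPoly d m)) ≠ 0 := Nat.cast_ne_zero.2 hd.ne'
  have h := cmRoot_bqPoly_relation d m
  rw [sqrtM_eq d m hd]
  field_simp
  linear_combination h

/-- **`(√m)² = m`.** -/
theorem sqrtM_sq (hirr : Irreducible (cmPolyQ (bqPoly d m))) (hd : 0 < d) : sqrtM d m ^ 2 = (m : cmField (bqPoly d m)) := by
  haveI : Fact (Irreducible (cmPolyQ (bqPoly d m))) := ⟨hirr⟩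
  haveI := charZero_cmField_bqPoly d m hirr
  have hd' : (d : cmField (bqPoly d m)) ≠ 0 := Nat.cast_ne_zero.2 hd.ne'
  have h := cmRoot_bqPoly_relation d m
  rw [sqrtM_eq d m hd]
  field_simp
  linear_combination h

/-- `1 - √m ≠ 0`, `1 + √m ≠ 0` and `1 - m ≠ 0` in `L` (`m` is not a square). -/
theorem one_sub_sqrtM_ne_zero (hirr : Irreducible (cmPolyQ (bqPoly d m))) (hd : 0 < d) (hm : ¬ IsSquare m) :
    1 - sqrtM d m ≠ 0 ∧ 1 + sqrtM d m ≠ 0 ∧ (1 : cmField (bqPoly d m)) - (m : cmField (bqPoly d m)) ≠ 0 := by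
  haveI := charZero_cmField_bqPoly d m hirr
  have hm1 : (m : cmField (bqPoly d m)) ≠ 1 := by exact_mod_cast ne_one_of_not_isSquare hm
  have hsq := sqrtM_sq d m hirr hd
  refine ⟨fun h => hm1 ?_, fun h => hm1 ?_, fun h => hm1 (sub_eq_zero.1 h).symm⟩
  · have : sqrtM d m = 1 := (sub_eq_zero.1 h).symm
    rw [← hsq, this, one_pow]
  · have : sqrtM d m = -1 := (neg_eq_of_add_eq_zero_right h).symm
    rw [← hsq, this, neg_one_sq]

/-- `√-d` in field form: `√-d = t(1 - √m)/(1 - m)`. -/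
theorem iK_eq [hF : Fact (Irreducible (cmPolyQ (bqPoly d m)))] (hm : ¬ IsSquare m) :
    iK d m = cmRoot (bqPoly d m) * (1 - sqrtM d m) / (1 - (m : cmField (bqPoly d m))) := by
  haveI := charZero_cmField_bqPoly d m hF.out
  have hm1 : (1 : ℚ) - (m : ℚ) ≠ 0 := by
    have : (m : ℚ) ≠ 1 := by exact_mod_cast ne_one_of_not_isSquare hm
    intro h; exact this (by linarith)
  rw [iK, map_inv₀, map_sub, map_one, map_natCast]
  field_simp

/-- **`√-d · (1 + √m) = t`.** -/
theorem iK_mul_one_add_sqrtM (hirr : Irreducible (cmPolyQ (bqPoly d m))) (hd : 0 < d) (hm : ¬ IsSquare m) :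
    iK d m * (1 + sqrtM d m) = cmRoot (bqPoly d m) := by
  haveI : Fact (Irreducible (cmPolyQ (bqPoly d m))) := ⟨hirr⟩
  obtain ⟨-, -, h1m⟩ := one_sub_sqrtM_ne_zero d m hirr hd hm
  have hsq := sqrtM_sq d m hirr hd
  rw [iK_eq d m hm, div_mul_eq_mul_div, div_eq_iff h1m]
  linear_combination (-cmRoot (bqPoly d m)) * hsq

/-- **`(√-d)² = -d`.** -/
theorem iK_sq (hirr : Irreducible (cmPolyQ (bqPoly d m))) (hd : 0 < d) (hm : ¬ IsSquare m) :
    iK d m ^ 2 = -(d : cmField (bqPoly d m)) := by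
  haveI : Fact (Irreducible (cmPolyQ (bqPoly d m))) := ⟨hirr⟩
  obtain ⟨-, h1p, -⟩ := one_sub_sqrtM_ne_zero d m hirr hd hm
  have ht := cmRoot_sq_eq d m hirr hd
  have h := iK_mul_one_add_sqrtM d m hirr hd hm
  have h2 : (iK d m * (1 + sqrtM d m)) ^ 2 = -((d : cmField (bqPoly d m)) * (1 + sqrtM d m) ^ 2) := by rw [h, ht]
  have h3 : (iK d m ^ 2 + (d : cmField (bqPoly d m))) * (1 + sqrtM d m) ^ 2 = 0 := by linear_combination h2
  rcases mul_eq_zero.1 h3 with h4 | h4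
  · exact eq_neg_of_add_eq_zero_left h4
  · exact absurd (pow_eq_zero_iff two_ne_zero |>.1 h4) h1p

/-- `√-d ≠ 0`. -/
theorem iK_ne_zero (hirr : Irreducible (cmPolyQ (bqPoly d m))) (hd : 0 < d) (hm : ¬ IsSquare m) : iK d m ≠ 0 := by
  haveI : Fact (Irreducible (cmPolyQ (bqPoly d m))) := ⟨hirr⟩
  haveI := charZero_cmField_bqPoly d m hirr
  intro h0
  have h1 := iK_sq d m hirr hd hm
  rw [h0, zero_pow two_ne_zero] at h1
  exact (Nat.cast_ne_zero.2 hd.ne') (neg_eq_zero.1 h1.symm)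

/-- The powers of `t` on the `K`-basis `{1, √m}`: `t² = -d(1+m) - 2d·√m`. -/
theorem cmRoot_sq_eq' (hirr : Irreducible (cmPolyQ (bqPoly d m))) (hd : 0 < d) :
    cmRoot (bqPoly d m) ^ 2 = -(d : cmField (bqPoly d m)) * (1 + (m : cmField (bqPoly d m))) -
      2 * (d : cmField (bqPoly d m)) * sqrtM d m := by
  rw [cmRoot_sq_eq d m hirr hd]
  linear_combination (-(d : cmField (bqPoly d m))) * sqrtM_sq d m hirr hd

/-- `t³ = -d·√-d·((1+3m) + (3+m)√m)`. -/
theorem cmRoot_pow_three_eq (hirr : Irreducible (cmPolyQ (bqPoly d m))) (hd : 0 < d) (hm : ¬ IsSquare m) :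
    cmRoot (bqPoly d m) ^ 3 = -(d : cmField (bqPoly d m)) * iK d m *
      ((1 + 3 * (m : cmField (bqPoly d m))) + (3 + (m : cmField (bqPoly d m))) * sqrtM d m) := by
  have h := iK_mul_one_add_sqrtM d m hirr hd hm
  have ht := cmRoot_sq_eq' d m hirr hd
  have hsq := sqrtM_sq d m hirr hd
  rw [pow_succ, ht, ← h]
  linear_combination (-(2 : cmField (bqPoly d m)) * (d : cmField (bqPoly d m)) * iK d m) * hsq

/-! ### The embedding `K ↪ L` -/

/-- `√-d ∈ L` is a root of `T² + d`. -/
theorem eval₂_cmPolyQ_quadratic_iK (hirr : Irreducible (cmPolyQ (bqPoly d m))) (hd : 0 < d) (hm : ¬ IsSquare m) :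
    (cmPolyQ (X + C (d : ℤ))).eval₂ (algebraMap ℚ (cmField (bqPoly d m))) (iK d m) = 0 := by
  rw [cmPolyQ_quadratic, eval₂_add, eval₂_pow, eval₂_X, eval₂_C, map_natCast, iK_sq d m hirr hd hm, neg_add_cancel]

/-! ### The embedding `K ↪ L` (a ring homomorphism; it is automatically `ℚ`-linear) -/

/-- **The embedding `K = ℚ(√-d) ↪ L = ℚ(√-d, √m)`, `t_K ↦ √-d`** (defined for `d ≥ 1`, `m` not a square and
`P_R` irreducible, i.e. `L` a field). -/
def toL (hirr : Irreducible (cmPolyQ (bqPoly d m))) (hd : 0 < d) (hm : ¬ IsSquare m) :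
    cmField (X + C (d : ℤ)) →+* cmField (bqPoly d m) :=
  AdjoinRoot.lift (algebraMap ℚ (cmField (bqPoly d m))) (iK d m) (eval₂_cmPolyQ_quadratic_iK d m hirr hd hm)

/-- `toL t_K = √-d`. -/
theorem toL_cmRoot (hirr : Irreducible (cmPolyQ (bqPoly d m))) (hd : 0 < d) (hm : ¬ IsSquare m) :
    toL d m hirr hd hm (cmRoot (X + C (d : ℤ))) = iK d m :=
  AdjoinRoot.lift_root _

/-- `toL` is the identity on rational constants. -/
theorem toL_algebraMap (hirr : Irreducible (cmPolyQ (bqPoly d m))) (hd : 0 < d) (hm : ¬ IsSquare m) (q : ℚ) :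
    toL d m hirr hd hm (algebraMap ℚ (cmField (X + C (d : ℤ))) q) = algebraMap ℚ (cmField (bqPoly d m)) q :=
  AdjoinRoot.lift_of _

/-- `toL ∘ (ℚ → K) = (ℚ → L)`. -/
theorem toL_comp_algebraMap (hirr : Irreducible (cmPolyQ (bqPoly d m))) (hd : 0 < d) (hm : ¬ IsSquare m) :
    (toL d m hirr hd hm).comp (algebraMap ℚ (cmField (X + C (d : ℤ)))) = algebraMap ℚ (cmField (bqPoly d m)) :=
  RingHom.ext (toL_algebraMap d m hirr hd hm)

/-- `toL` intertwines the complex conjugations (`t_K ↦ -t_K`, `√-d ↦ -√-d`). -/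
theorem toL_cmConj (hirr : Irreducible (cmPolyQ (bqPoly d m))) (hd : 0 < d) (hm : ¬ IsSquare m)
    (z : cmField (X + C (d : ℤ))) :
    toL d m hirr hd hm (cmConj (X + C (d : ℤ)) z) = cmConj (bqPoly d m) (toL d m hirr hd hm z) := by
  obtain ⟨a, b, rfl⟩ := exists_eq_add_mul_cmRoot_quadratic d z
  rw [map_add, map_mul, AlgHom.commutes, AlgHom.commutes, cmConj_cmRoot, mul_neg, map_add, map_neg, map_mul,
    toL_algebraMap, toL_algebraMap, toL_cmRoot, map_add, map_mul, toL_algebraMap, toL_algebraMap, toL_cmRoot,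
    map_add, map_mul, AlgHom.commutes, AlgHom.commutes, cmConj_iK, mul_neg]

/-- **`√m ∉ K`** (inside `L`): `√m` is not in the image of `toL` (`m` is not a square). -/
theorem sqrtM_not_mem_range_toL (hirr : Irreducible (cmPolyQ (bqPoly d m))) (hd : 0 < d) (hm : ¬ IsSquare m) :
    sqrtM d m ∉ Set.range (toL d m hirr hd hm) := by
  rintro ⟨z, hz⟩
  obtain ⟨a, b, rfl⟩ := exists_eq_add_mul_cmRoot_quadratic d z
  rw [map_add, map_mul, toL_algebraMap, toL_algebraMap, toL_cmRoot] at hz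
  -- apply complex conjugation: `a - b√-d = √m = a + b√-d`
  have hc := congrArg (cmConj (bqPoly d m)) hz
  rw [cmConj_sqrtM, map_add, map_mul, AlgHom.commutes, AlgHom.commutes, cmConj_iK, ← hz] at hc
  -- freeze the structure map before making `L` a field (the `ℚ`-algebra instance changes shape)
  set ι : ℚ →+* cmField (bqPoly d m) := algebraMap ℚ (cmField (bqPoly d m)) with hι
  have h2 : (2 : cmField (bqPoly d m)) * (ι b * iK d m) = 0 := by linear_combination -hc
  have hsq := sqrtM_sq d m hirr hd
  haveI : Fact (Irreducible (cmPolyQ (bqPoly d m))) := ⟨hirr⟩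
  haveI := charZero_cmField_bqPoly d m hirr
  have hb : ι b = 0 :=
    (mul_eq_zero.1 ((mul_eq_zero.1 h2).resolve_left two_ne_zero)).resolve_right (iK_ne_zero d m hirr hd hm)
  rw [hb, zero_mul, add_zero] at hz
  -- `√m = a` rational, so `m = a²` is a square
  rw [← hz, ← map_pow, ← map_natCast ι m] at hsq
  have ha : a ^ 2 = (m : ℚ) := ι.injective hsq
  exact hm (Rat.isSquare_natCast_iff.1 ⟨a, by rw [← ha, sq]⟩)

end FieldFacts

end Summit.HodgeConjecture.HodgeConjecture.BiquadraticSecantLift
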